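import Summits.QuantumFields.YangMills.Theorems.ReplicaVarianceTiltHeightChiSqLAbsCont
import Summits.QuantumFields.YangMills.Theorems.ReplicaVarianceTiltHeightChiSqLDataProcessing

/-!
# Route `ReplicaVarianceTilt` — crux `HeightChiSqL` (stmt-QuantumFields-26133), registered stub `stub_acIntegrable`:
# the stub IS EQUIVALENT to square-integrability of Bałaban's one-step renormalised weight `w_K` on the finest small-field window
# (helper `--supports stmt-QuantumFields-26133`; the stub stays open)

Width seat `ym-line-sfw-p2-w3` gen 21 (home cell `ym-idea-1`; R3 RECORD rung — no summit, no rung and no crux is proved here; the YM mass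
gap is NOT proved by any of this).  Third file of the series: `…HeightChiSqLAbsCont` (a.c. conjunct, unconditional),
`…HeightChiSqLDataProcessing` (chi-square contracts along the tower ⇒ integrability from `∫_S w_K²·e^{β_K A} dU < ∞`).  Notation as there:
`S = histGood K n`, `b = e^{−β_K A}`, `w_K = T₀^{(K+1)}(1_{PlaqSmall θ(K+1)}·e^{−β_{K+1}A})` read on run `K`'s finest lattice, `ρ⁰`/`ρ¹` the two
runs' restricted height densities at the comparison height `n`.

* §3 THE CONVERSE WITH NO FREE TOP STEP (`oneStepWeightSq_of_integrable_chiSq_top`, `K − n = 0`, the stub's `m = 1`, `n = ⌊K/1⌋`): there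
  `ρ⁰ = 1_S·b` and `ρ¹ = 1_S·w_K` read through the level identification (cast along `K − ⌊K/1⌋ = 0`, `towerDensity_of_eq_zero`), so
  integrability of `(ρ¹)²/ρ⁰` IS `∫_S w_K²/b dU < ∞`.
* §4 in the stub's LITERAL quantifier prefix: `stubText_iff_oneStepWeightSqOnWindow` — **the registered stub holds iff for every block size
  `L` and profile `(b₀, p₀)` there is `γ₁ > 0` such that for all families of block size `L`, all `0 < γ ≤ γ₁` and all cut-offs `K`,
  `∫_{PlaqSmall θ(K)} w_K²·e^{β_K A} dU < ∞`** (⇐ `stubText_of_oneStepWeightSqOnWindow`: a.c. from the first file, integrability by data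
  processing since the window `histGood K ⌊K/m⌋` only shrinks as `m` grows; ⇒ `oneStepWeightSqOnWindow_of_stubText`: the `m = 1` instance
  and §3).
HONEST READING (for the critic / whoever staffs 26133): the «M» stub is therefore EXACTLY an `L²` statement about the image law of ONE (0.4)
block averaging restricted to the finest small-field window (`w_K ≤ d(avg_* dU)/dV` there); the tree has absolute continuity of that image
law (`HaarAC`, `BlockAveragingEMLFibreLawSUN`) and nothing quantitative (exact Haar compatibility «E6′» is open,
`AveragingImageLawGaugeInvariance`); an `L²`/`L^∞` bound of the image density on the window would need a quantitative (Jacobian) form of the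
tangent-injectivity behind `HaarAC` (`T4EMLTangentInjective`).  No estimate of Bałaban's is used or asserted anywhere in this file.

References: T. Bałaban, CMP 102 (1985) 255–275 [Balaban1985UV3] ((2) p.256, (7) p.257); C. King, CMP 102 (1986) 649–677 [King1986]
(§3.2 p.656).
-/
noncomputable section

open MeasureTheory Filter Topology
open scoped ENNReal
open Literature.MathematicalPhysics.QuantumFieldTheory.Balaban1983to89
open Literature.MathematicalPhysics.QuantumFieldTheory.Balaban1983to89.T3ContinuumYM3Torus
open Literature.MathematicalPhysics.QuantumFieldTheory.Balaban1983to89.T3LevelShift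
open Literature.MathematicalPhysics.QuantumFieldTheory.Balaban1983to89.T3UnitLawDensityEML
open Literature.MathematicalPhysics.QuantumFieldTheory.Balaban1983to89.T3UnitScaleTilt
open Literature.MathematicalPhysics.QuantumFieldTheory.Balaban1983to89.T3RestrictedUnitDensity
open Literature.MathematicalPhysics.QuantumFieldTheory.Balaban1983to89.T3TiltDescent
open Literature.MathematicalPhysics.QuantumFieldTheory.Balaban1983to89.Missing
open Literature.MathematicalPhysics.QuantumFieldTheory.Balaban1983to89.T4Continuum
open Summit.QuantumFields.YangMills.Theorems.LogComparisonOneTower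

open Summit.QuantumFields.YangMills.Theorems.HeightChiSqLDataProcessing

namespace Summit.QuantumFields.YangMills.Theorems.HeightChiSqLOneStepWindow

/-! ## §3 No free top step: the converse -/

section NoFreeStep

variable (F : T3Family) (K : ℕ)

/-- At level `0` the Radon–Nikodym tower is its initial density, read through the trivial level identification (a cast along `k = 0`,
usable at `k = K − ⌊K/1⌋`). [cite: Balaban1985UV3, (2) p.256] -/
theorem towerDensity_of_eq_zero (ρ₀ : Density (F.P K) 0 (Matrix.specialUnitaryGroup (Fin 2) ℂ)) {k : ℕ} (e : k = 0)
    (W : GaugeField (F.P K) k (Matrix.specialUnitaryGroup (Fin 2) ℂ)) :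
    towerDensity F K ρ₀ k W =
      ρ₀ (fieldShift (F.sitesPerDir_eq (m := F.m) (K := K) (j := 0) (m' := F.m) (K' := K) (j' := k) (by omega)) W) := by
  subst e
  rw [towerDensity_zero, fieldShift_refl]

variable {γ : ℝ} (hγ : 0 ≤ γ) (θ : ℕ → ℝ) {n : ℕ} (hK : n ≤ K) (hKn : K - n = 0)

include hγ hKn in
/-- **THE CONVERSE WITH NO FREE TOP STEP** (`K − n = 0`, i.e. the stub's `m = 1`, `n = ⌊K/1⌋`): then the two restricted height densities ARE
`1_S·e^{−β_K A}` and `1_S·w_K` read through the level identification (`S = histGood K n`), so integrability of the chi-square integrand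
`(ρ¹)²/ρ⁰` on the comparison lattice gives `∫_S w_K²·e^{β_K A} dU < ∞` on run `K`'s finest lattice. [cite: King1986, §3.2 p.656] -/
theorem oneStepWeightSq_of_integrable_chiSq_top
    (hint : Integrable (fun V => heightDensity F γ (hK.trans (Nat.le_succ K)) (histGood F ℰp θ (K + 1) n) V ^ 2 /
        heightDensity F γ hK (histGood F ℰp θ K n) V) (fieldMeasure (F.P n) 0 (Matrix.specialUnitaryGroup (Fin 2) ℂ))) :
    Integrable ((histGood F ℰp θ K n).indicator fun U =>
        resDensity F γ (K + 1) {U' | PlaqSmall (θ (K + 1)) U'} 1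
            (fieldShift (F.sitesPerDir_eq (m := F.m) (K := K + 1) (j := 1) (m' := F.m) (K' := K) (j' := 0) (by omega)) U) ^ 2 /
          boltzmann (F.P K) ((F.scheme ℰp γ).β K) U)
      (fieldMeasure (F.P K) 0 (Matrix.specialUnitaryGroup (Fin 2) ℂ)) := by
  have hS := measurableSet_histGood F ℰp measurableE_ℰp θ K n
  set μ₀ := fieldMeasure (F.P K) 0 (Matrix.specialUnitaryGroup (Fin 2) ℂ) with hμ₀
  set S := histGood F ℰp θ K n with hSdef
  set b : Density (F.P K) 0 (Matrix.specialUnitaryGroup (Fin 2) ℂ) := S.indicator (boltzmann (F.P K) ((F.scheme ℰp γ).β K)) with hb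
  set w : Density (F.P K) 0 (Matrix.specialUnitaryGroup (Fin 2) ℂ) := S.indicator (fun U => resDensity F γ (K + 1) {U' | PlaqSmall (θ (K + 1)) U'} 1
      (fieldShift (F.sitesPerDir_eq (m := F.m) (K := K + 1) (j := 1) (m' := F.m) (K' := K) (j' := 0) (by omega)) U)) with hw
  have hbm : Measurable b := (measurable_boltzmann RegularGaugeGroup.measurable_reTr _ _).indicator hS
  have hwm : Measurable w := (measurable_oneStepWeight F γ K θ).indicator hS
  have hfg : (fun U => w U ^ 2 / b U) = S.indicator (fun U =>
      resDensity F γ (K + 1) {U' | PlaqSmall (θ (K + 1)) U'} 1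
          (fieldShift (F.sitesPerDir_eq (m := F.m) (K := K + 1) (j := 1) (m' := F.m) (K' := K) (j' := 0) (by omega)) U) ^ 2 /
        boltzmann (F.P K) ((F.scheme ℰp γ).β K) U) := by
    funext U
    by_cases hU : U ∈ S
    · simp only [hw, hb, Set.indicator_of_mem hU]
    · simp only [hw, hb, Set.indicator_of_notMem hU]
      simp
  -- the two level identifications and their composite `(F.P K)₀ ← (F.P n)₀`
  have hup := F.sitesPerDir_eq (m := F.m) (K := K) (j := K - n) (m' := F.m) (K' := n) (j' := 0) (by omega)
  have h0 := F.sitesPerDir_eq (m := F.m) (K := K) (j := 0) (m' := F.m) (K' := K) (j' := K - n) (by omega)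
  have hc : (F.PP F.m K).sitesPerDir 0 = (F.PP F.m n).sitesPerDir 0 := h0.trans hup
  have hsucc := heightDensity_succ_ae_eq F hγ K θ hK
  have hae : (fun V => heightDensity F γ (hK.trans (Nat.le_succ K)) (histGood F ℰp θ (K + 1) n) V ^ 2 /
        heightDensity F γ hK (histGood F ℰp θ K n) V) =ᵐ[fieldMeasure (F.P n) 0 (Matrix.specialUnitaryGroup (Fin 2) ℂ)]
      (fun V => w (fieldShift hc V) ^ 2 / b (fieldShift hc V)) := by
    filter_upwards [hsucc] with V hV
    have hnum : heightDensity F γ (hK.trans (Nat.le_succ K)) (histGood F ℰp θ (K + 1) n) V = w (fieldShift hc V) := by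
      rw [hV, towerDensity_of_eq_zero F K _ hKn, fieldShift_fieldShift]
    have hden : heightDensity F γ hK (histGood F ℰp θ K n) V = b (fieldShift hc V) := by
      show towerDensity F K b (K - n) (fieldShift hup V) = _
      rw [towerDensity_of_eq_zero F K _ hKn, fieldShift_fieldShift]
    rw [hnum, hden]
  have hG : Integrable ((fun U => w U ^ 2 / b U) ∘ fieldShift hc) (fieldMeasure (F.P n) 0 (Matrix.specialUnitaryGroup (Fin 2) ℂ)) :=
    hint.congr hae
  have hmp := measurePreserving_fieldShift (G := Matrix.specialUnitaryGroup (Fin 2) ℂ) hc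
  have hGm : AEStronglyMeasurable (fun U => w U ^ 2 / b U) μ₀ := ((hwm.pow_const 2).div hbm).aestronglyMeasurable
  have hres : Integrable (fun U => w U ^ 2 / b U) μ₀ := (hmp.integrable_comp hGm).mp hG
  rw [hfg] at hres
  exact hres

end NoFreeStep

/-! ## §4 In the registered stub's quantifier prefix: the stub ⟺ square-integrability of `w_K` on the finest small-field window -/

section Stub

/-- **`stub_acIntegrable` ⇐ SQUARE-INTEGRABILITY OF THE ONE-STEP WEIGHT ON THE FINEST WINDOW**: if for every block size `L` and profile
`(b₀, p₀)` there is `γ₁ > 0` such that for every family of block size `L`, every `0 < γ ≤ γ₁` and every `K` the one-step renormalised weight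
`w_K` is square-integrable against `e^{β_K A} dU` on the finest small-field window `histGood K K = {PlaqSmall θ(K)}`, then the literal text
of the registered stub holds (a.c. conjunct: `ReplicaVarianceTiltHeightChiSqLAbsCont`; integrability: §2, the window only shrinks with
`m`). [cite: King1986, §3.2 p.656] -/
theorem stubText_of_oneStepWeightSqOnWindow
    (hyp : ∀ (L : ℕ) (b₀ p₀ : ℝ), 0 < b₀ → 2 < p₀ → ∃ γ₁ : ℝ, 0 < γ₁ ∧
      ∀ (F : T3Family) (γ : ℝ), F.L = L → 0 < γ → γ ≤ γ₁ → ∀ K : ℕ,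
        Integrable ((histGood F ℰp (θBal F.L γ b₀ p₀) K K).indicator fun U =>
            resDensity F γ (K + 1) {U' | PlaqSmall (θBal F.L γ b₀ p₀ (K + 1)) U'} 1
                (fieldShift (F.sitesPerDir_eq (m := F.m) (K := K + 1) (j := 1) (m' := F.m) (K' := K) (j' := 0) (by omega)) U) ^ 2 /
              boltzmann (F.P K) ((F.scheme ℰp γ).β K) U)
          (fieldMeasure (F.P K) 0 (Matrix.specialUnitaryGroup (Fin 2) ℂ))) :
    ∀ (L : ℕ) (b₀ p₀ : ℝ), 0 < b₀ → 2 < p₀ → ∀ (m : ℕ), 0 < m → ∃ γ₁ : ℝ, 0 < γ₁ ∧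
      ∀ (F : T3Family) (γ : ℝ), F.L = L → 0 < γ → γ ≤ γ₁ → ∀ K : ℕ,
        (∀ᵐ V ∂fieldMeasure (F.P (K / m)) 0 (Matrix.specialUnitaryGroup (Fin 2) ℂ), heightDensity F γ (Nat.div_le_self K m) (histGood F ℰp (θBal F.L γ b₀ p₀) K (K / m)) V = 0 → heightDensity F γ ((Nat.div_le_self K m).trans (Nat.le_succ K)) (histGood F ℰp (θBal F.L γ b₀ p₀) (K + 1) (K / m)) V = 0) ∧
        Integrable (fun V => heightDensity F γ ((Nat.div_le_self K m).trans (Nat.le_succ K)) (histGood F ℰp (θBal F.L γ b₀ p₀) (K + 1) (K / m)) V ^ 2 / heightDensity F γ (Nat.div_le_self K m) (histGood F ℰp (θBal F.L γ b₀ p₀) K (K / m)) V) (fieldMeasure (F.P (K / m)) 0 (Matrix.specialUnitaryGroup (Fin 2) ℂ)) := by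
  intro L b₀ p₀ hb hp m _
  obtain ⟨γ₁, hγ₁, h⟩ := hyp L b₀ p₀ hb hp
  refine ⟨γ₁, hγ₁, fun F γ hL hγ hγ1 K => ⟨?_, ?_⟩⟩
  · exact HeightChiSqLAbsCont.heightDensity_histGood_succ_eq_zero_ae F hγ.le K (θBal F.L γ b₀ p₀) (Nat.div_le_self K m)
  · have hK := h F γ hL hγ hγ1 K
    have hSm := measurableSet_histGood F ℰp measurableE_ℰp (θBal F.L γ b₀ p₀) K (K / m)
    have hsub : histGood F ℰp (θBal F.L γ b₀ p₀) K (K / m) ⊆ histGood F ℰp (θBal F.L γ b₀ p₀) K K :=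
      histGood_mono_height F K (θBal F.L γ b₀ p₀) (Nat.div_le_self K m)
    have hg0 : ∀ U : GaugeField (F.P K) 0 (Matrix.specialUnitaryGroup (Fin 2) ℂ), 0 ≤
        resDensity F γ (K + 1) {U' | PlaqSmall (θBal F.L γ b₀ p₀ (K + 1)) U'} 1
            (fieldShift (F.sitesPerDir_eq (m := F.m) (K := K + 1) (j := 1) (m' := F.m) (K' := K) (j' := 0) (by omega)) U) ^ 2 /
          boltzmann (F.P K) ((F.scheme ℰp γ).β K) U :=
      fun U => div_nonneg (sq_nonneg _) (boltzmann_pos _ _ U).le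
    have hgm : Measurable fun U : GaugeField (F.P K) 0 (Matrix.specialUnitaryGroup (Fin 2) ℂ) =>
        resDensity F γ (K + 1) {U' | PlaqSmall (θBal F.L γ b₀ p₀ (K + 1)) U'} 1
            (fieldShift (F.sitesPerDir_eq (m := F.m) (K := K + 1) (j := 1) (m' := F.m) (K' := K) (j' := 0) (by omega)) U) ^ 2 /
          boltzmann (F.P K) ((F.scheme ℰp γ).β K) U :=
      ((measurable_oneStepWeight F γ K (θBal F.L γ b₀ p₀)).pow_const 2).div
        (measurable_boltzmann RegularGaugeGroup.measurable_reTr _ _)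
    have hmono := hK.mono' ((hgm.indicator hSm).aestronglyMeasurable) (ae_of_all _ fun U => by
      rw [Real.norm_eq_abs, abs_of_nonneg (Set.indicator_nonneg (fun U' _ => hg0 U') U)]
      exact Set.indicator_le_indicator_of_subset hsub (fun U' => hg0 U') U)
    exact (integrable_chiSq_of_oneStepWeightSq F hγ.le K (θBal F.L γ b₀ p₀) (Nat.div_le_self K m) hmono).1

/-- **`stub_acIntegrable` ⇒ SQUARE-INTEGRABILITY OF THE ONE-STEP WEIGHT ON THE FINEST WINDOW**: the stub's integrability conjunct at
`m = 1` (no free top step) IS `∫_{histGood K K} w_K²·e^{β_K A} dU < ∞` read through the level identification (§3). [cite: King1986, §3.2 p.656] -/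
theorem oneStepWeightSqOnWindow_of_stubText
    (hstub : ∀ (L : ℕ) (b₀ p₀ : ℝ), 0 < b₀ → 2 < p₀ → ∀ (m : ℕ), 0 < m → ∃ γ₁ : ℝ, 0 < γ₁ ∧
      ∀ (F : T3Family) (γ : ℝ), F.L = L → 0 < γ → γ ≤ γ₁ → ∀ K : ℕ,
        (∀ᵐ V ∂fieldMeasure (F.P (K / m)) 0 (Matrix.specialUnitaryGroup (Fin 2) ℂ), heightDensity F γ (Nat.div_le_self K m) (histGood F ℰp (θBal F.L γ b₀ p₀) K (K / m)) V = 0 → heightDensity F γ ((Nat.div_le_self K m).trans (Nat.le_succ K)) (histGood F ℰp (θBal F.L γ b₀ p₀) (K + 1) (K / m)) V = 0) ∧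
        Integrable (fun V => heightDensity F γ ((Nat.div_le_self K m).trans (Nat.le_succ K)) (histGood F ℰp (θBal F.L γ b₀ p₀) (K + 1) (K / m)) V ^ 2 / heightDensity F γ (Nat.div_le_self K m) (histGood F ℰp (θBal F.L γ b₀ p₀) K (K / m)) V) (fieldMeasure (F.P (K / m)) 0 (Matrix.specialUnitaryGroup (Fin 2) ℂ))) :
    ∀ (L : ℕ) (b₀ p₀ : ℝ), 0 < b₀ → 2 < p₀ → ∃ γ₁ : ℝ, 0 < γ₁ ∧
      ∀ (F : T3Family) (γ : ℝ), F.L = L → 0 < γ → γ ≤ γ₁ → ∀ K : ℕ,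
        Integrable ((histGood F ℰp (θBal F.L γ b₀ p₀) K K).indicator fun U =>
            resDensity F γ (K + 1) {U' | PlaqSmall (θBal F.L γ b₀ p₀ (K + 1)) U'} 1
                (fieldShift (F.sitesPerDir_eq (m := F.m) (K := K + 1) (j := 1) (m' := F.m) (K' := K) (j' := 0) (by omega)) U) ^ 2 /
              boltzmann (F.P K) ((F.scheme ℰp γ).β K) U)
          (fieldMeasure (F.P K) 0 (Matrix.specialUnitaryGroup (Fin 2) ℂ)) := by
  intro L b₀ p₀ hb hp
  obtain ⟨γ₁, hγ₁, h⟩ := hstub L b₀ p₀ hb hp 1 one_pos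
  refine ⟨γ₁, hγ₁, fun F γ hL hγ hγ1 K => ?_⟩
  obtain ⟨-, hint⟩ := h F γ hL hγ hγ1 K
  have hres := oneStepWeightSq_of_integrable_chiSq_top F K hγ.le (θBal F.L γ b₀ p₀) (Nat.div_le_self K 1) (by omega) hint
  simpa only [Nat.div_one] using hres

/-- **THE REGISTERED STUB `stub_acIntegrable` OF CRUX `HeightChiSqL` IS EQUIVALENT TO AN `L²` PROPERTY OF ONE AVERAGING STEP**: its literal
text holds iff for every block size and profile, at small coupling, Bałaban's one-step renormalised weight
`w_K = T₀^{(K+1)}(1_{PlaqSmall θ(K+1)}·e^{−β_{K+1}A})` (read on run `K`'s finest lattice) satisfies `∫_{PlaqSmall θ(K)} w_K²·e^{β_K A} dU < ∞`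
for every cut-off `K` — a statement about the image law of ONE (0.4) block averaging on the finest small-field window, of which the tree knows
absolute continuity only.  No estimate of Bałaban's is used. [cite: King1986, §3.2 p.656] -/
theorem stubText_iff_oneStepWeightSqOnWindow :
    (∀ (L : ℕ) (b₀ p₀ : ℝ), 0 < b₀ → 2 < p₀ → ∀ (m : ℕ), 0 < m → ∃ γ₁ : ℝ, 0 < γ₁ ∧
      ∀ (F : T3Family) (γ : ℝ), F.L = L → 0 < γ → γ ≤ γ₁ → ∀ K : ℕ,
        (∀ᵐ V ∂fieldMeasure (F.P (K / m)) 0 (Matrix.specialUnitaryGroup (Fin 2) ℂ), heightDensity F γ (Nat.div_le_self K m) (histGood F ℰp (θBal F.L γ b₀ p₀) K (K / m)) V = 0 → heightDensity F γ ((Nat.div_le_self K m).trans (Nat.le_succ K)) (histGood F ℰp (θBal F.L γ b₀ p₀) (K + 1) (K / m)) V = 0) ∧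
        Integrable (fun V => heightDensity F γ ((Nat.div_le_self K m).trans (Nat.le_succ K)) (histGood F ℰp (θBal F.L γ b₀ p₀) (K + 1) (K / m)) V ^ 2 / heightDensity F γ (Nat.div_le_self K m) (histGood F ℰp (θBal F.L γ b₀ p₀) K (K / m)) V) (fieldMeasure (F.P (K / m)) 0 (Matrix.specialUnitaryGroup (Fin 2) ℂ))) ↔
    (∀ (L : ℕ) (b₀ p₀ : ℝ), 0 < b₀ → 2 < p₀ → ∃ γ₁ : ℝ, 0 < γ₁ ∧
      ∀ (F : T3Family) (γ : ℝ), F.L = L → 0 < γ → γ ≤ γ₁ → ∀ K : ℕ,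
        Integrable ((histGood F ℰp (θBal F.L γ b₀ p₀) K K).indicator fun U =>
            resDensity F γ (K + 1) {U' | PlaqSmall (θBal F.L γ b₀ p₀ (K + 1)) U'} 1
                (fieldShift (F.sitesPerDir_eq (m := F.m) (K := K + 1) (j := 1) (m' := F.m) (K' := K) (j' := 0) (by omega)) U) ^ 2 /
              boltzmann (F.P K) ((F.scheme ℰp γ).β K) U)
          (fieldMeasure (F.P K) 0 (Matrix.specialUnitaryGroup (Fin 2) ℂ))) :=
  ⟨oneStepWeightSqOnWindow_of_stubText, stubText_of_oneStepWeightSqOnWindow⟩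

end Stub

end Summit.QuantumFields.YangMills.Theorems.HeightChiSqLOneStepWindow

end
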